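import Summits.ResolutionOfSingularities.ResolutionOfSingularities.Theorems.EquisingularLiftEquisingularLiftNatMultisectionAdapter
import Summits.ResolutionOfSingularities.ResolutionOfSingularities.Theorems.EquisingularLiftEquisingularLiftNatPointTail
import HarnessLib

/-!
# [OURS · L1 W4.5(b) · EL♮] T-TAIL ∘ ADAPTER: point-resolvable strict transforms finish the chain, with the multisection device
# DISCHARGED for `Adm :⟺ embedding dimension ≤ n` (crux `EquisingularLiftNat` = stmt-ResolutionOfSingularities-20038)

HONEST FRAMING. OURS (cell res-hironaka, crux chain w45b, slot W4.5(b)); NOT a statement of any manuscript; AI-written,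
weaker than expert review. Helper `--supports stmt-ResolutionOfSingularities-20038 --as helper`. This file is the «one call»
of CHAIN v7.3 §1 (ii): T-TAIL (`horizChainE1_of_pointResolvable` p508794 / `horizChainE1_of_pointResolvableInv` p510285,
res-D-pv-013) with its hypotheses `Adm`, `hAdm`, `hMS` instantiated by the adapter `hMS_of_multisection` (p513364) at
`Adm Γ x :⟺ μ(𝔪_{Γ,x}) ≤ n`. What a caller still supplies beyond T-TAIL's own binder: `P` integral, `O` a COMPLETE DVR with
ALGEBRAICALLY CLOSED residue field, and the dimension input `hdim` (T-DIM, res-L1-w45b-stub-2 g4).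

* `horizChainE1_of_pointResolvable_embDim` — if the reduced strict transform of a `Ch`-stage is isomorphic to a scheme `Γ` from
  which a regular scheme is reached by blow-ups at closed non-regular points of embedding dimension `≤ n`, then some `Ch`-stage
  has regular reduced strict transform.
* `horizChainE1_of_pointResolvableInv_embDim` — the same with the downstairs closure asked only of iso-invariant predicates.

References: Matsumura, *Commutative Ring Theory*, Thm. 8.4, 14.2 [Matsumura1987] — through the cited tree files.
-/

set_option linter.dupNamespace false -- mandated namespace `Summit.<Summit>.<Problem>` of this single-conjunct summit

open CategoryTheory CategoryTheory.Limits AlgebraicGeometry TopologicalSpace Topology IsLocalRing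
open Literature.AlgebraicGeometry.Resolution
open AlgebraicGeometry.Scheme.IdealSheafData
open Summit.ResolutionOfSingularities.ResolutionOfSingularities.Theses.EquisingularLift.Split
open Summit.ResolutionOfSingularities.ResolutionOfSingularities.Cruxes.EquisingularLift.StrataSplit

namespace Summit.ResolutionOfSingularities.ResolutionOfSingularities.Cruxes.EquisingularLiftNat.Sections

/-- **T-TAIL with the multisection device discharged (`Adm :⟺ μ(𝔪_{Γ,x}) ≤ n`).** In the setting of `pointStep`/T-TAIL with `P`
integral over a COMPLETE discrete valuation ring `O` with ALGEBRAICALLY CLOSED residue field, and given T-DIM's `hdim`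
(«`dim 𝒪_{X',x} = n + 1` at closed special points of `Ch`-stages»): if the reduced strict transform of the `Ch`-stage
`(X', σ', S')` is isomorphic to `Γ`, and a regular scheme is reached from `Γ` by blow-ups at closed non-regular points `x` with
`μ(𝔪_{Γ₁,x}) ≤ n`, then some `Ch`-stage has regular reduced strict transform (`horizChainE1_of_pointResolvable` fed with
`hMS_of_multisection` and `spanFinrank_maximalIdeal_stalk_le_of_iso`). [folklore packaging; cite: Matsumura1987, Thm. 8.4] -/
theorem horizChainE1_of_pointResolvable_embDim (O : Type) [CommRing O] [IsDomain O] [IsDiscreteValuationRing O]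
    [IsAdicComplete (maximalIdeal O) O] [IsAlgClosed (ResidueField O)]
    (P : Scheme.{0}) [IsIntegral P] (q : P ⟶ Spec (.of O)) (Y : Closeds P)
    (Ch : ∀ X' : Scheme.{0}, (X' ⟶ P) → Set X' → Prop)
    (hChain : ∀ (X' : Scheme.{0}) (σ : X' ⟶ P) (S : Set X'), Ch X' σ S → Chain P (Y : Set P) X' σ S)
    (hStep : ∀ (X' X'' : Scheme.{0}) (σ' : X' ⟶ P) (S' : Set X') (C : X'.IdealSheafData) (τ : X'' ⟶ X'),
      Ch X' σ' S' → IsBlowup τ C → Scheme.IsRegular C.subscheme → Flat (C.subschemeι ≫ σ' ≫ q) →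
      σ' '' (C.support : Set X') ⊆ {x : P | ¬ IsGenericPoint x (Y : Set P)} →
      (C.support : Set X') ∩ (σ' ≫ q) ⁻¹' {IsLocalRing.closedPoint O} ⊆ S' →
      Ch X'' (τ ≫ σ') (closure (τ ⁻¹' (S' \ (C.support : Set X')))))
    (hq : Smooth q) (hqp : IsProper q)
    (hY : (Y : Set P) ⊆ q ⁻¹' {IsLocalRing.closedPoint O}) (hYirr : IsIrreducible (Y : Set P)) (n : ℕ)
    (hdim : ∀ (X' : Scheme.{0}) (σ' : X' ⟶ P) (S' : Set X'), Ch X' σ' S' → ∀ x : X', IsClosed ({x} : Set X') →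
      (σ' ≫ q) x = IsLocalRing.closedPoint O → ringKrullDim (X'.presheaf.stalk x) = (n + 1 : ℕ))
    -- the upstairs stage, the downstairs scheme and their identification
    (X' : Scheme.{0}) (σ' : X' ⟶ P) (S' : Set X') (hCh : Ch X' σ' S')
    (Γ : Scheme.{0}) (e : Γ ≅ (vanishingIdeal (⟨closure S', isClosed_closure⟩ : Closeds X')).subscheme)
    -- point-resolvability of `Γ` by blow-ups at closed non-regular points of embedding dimension `≤ n`
    (hres : ∃ Γs : Scheme.{0}, (∀ R : Scheme.{0} → Prop, R Γ →
      (∀ (Γ₁ Γ₂ : Scheme.{0}) (x : Γ₁) (hx : IsClosed ({x} : Set Γ₁)) (υ : Γ₂ ⟶ Γ₁), R Γ₁ →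
        ¬ IsRegularLocalRing (Γ₁.presheaf.stalk x) → (maximalIdeal (Γ₁.presheaf.stalk x)).spanFinrank ≤ n →
        IsBlowup υ (vanishingIdeal ⟨{x}, hx⟩) → R Γ₂) → R Γs) ∧
      Scheme.IsRegular Γs) :
    ∃ (X₁ : Scheme.{0}) (σ₁ : X₁ ⟶ P) (S₁ : Set X₁), Ch X₁ σ₁ S₁ ∧
      Scheme.IsRegular (vanishingIdeal (⟨closure S₁, isClosed_closure⟩ : Closeds X₁)).subscheme :=
  horizChainE1_of_pointResolvable O P q Y Ch hChain hStep hq hqp hY hYirr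
    (fun Γ₁ x => (maximalIdeal (Γ₁.presheaf.stalk x)).spanFinrank ≤ n) (spanFinrank_maximalIdeal_stalk_le_of_iso n)
    (hMS_of_multisection O P q Y Ch hChain hq hY hYirr n hdim) X' σ' S' hCh Γ e hres

/-- **T-TAIL (iso-invariant closure) with the multisection device discharged (`Adm :⟺ μ(𝔪_{Γ,x}) ≤ n`).** As
`horizChainE1_of_pointResolvable_embDim`, but the downstairs closure property is asked only of ISO-INVARIANT predicates
(`horizChainE1_of_pointResolvableInv`). [folklore packaging; cite: Matsumura1987, Thm. 8.4] -/
theorem horizChainE1_of_pointResolvableInv_embDim (O : Type) [CommRing O] [IsDomain O] [IsDiscreteValuationRing O]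
    [IsAdicComplete (maximalIdeal O) O] [IsAlgClosed (ResidueField O)]
    (P : Scheme.{0}) [IsIntegral P] (q : P ⟶ Spec (.of O)) (Y : Closeds P)
    (Ch : ∀ X' : Scheme.{0}, (X' ⟶ P) → Set X' → Prop)
    (hChain : ∀ (X' : Scheme.{0}) (σ : X' ⟶ P) (S : Set X'), Ch X' σ S → Chain P (Y : Set P) X' σ S)
    (hStep : ∀ (X' X'' : Scheme.{0}) (σ' : X' ⟶ P) (S' : Set X') (C : X'.IdealSheafData) (τ : X'' ⟶ X'),
      Ch X' σ' S' → IsBlowup τ C → Scheme.IsRegular C.subscheme → Flat (C.subschemeι ≫ σ' ≫ q) →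
      σ' '' (C.support : Set X') ⊆ {x : P | ¬ IsGenericPoint x (Y : Set P)} →
      (C.support : Set X') ∩ (σ' ≫ q) ⁻¹' {IsLocalRing.closedPoint O} ⊆ S' →
      Ch X'' (τ ≫ σ') (closure (τ ⁻¹' (S' \ (C.support : Set X')))))
    (hq : Smooth q) (hqp : IsProper q)
    (hY : (Y : Set P) ⊆ q ⁻¹' {IsLocalRing.closedPoint O}) (hYirr : IsIrreducible (Y : Set P)) (n : ℕ)
    (hdim : ∀ (X' : Scheme.{0}) (σ' : X' ⟶ P) (S' : Set X'), Ch X' σ' S' → ∀ x : X', IsClosed ({x} : Set X') →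
      (σ' ≫ q) x = IsLocalRing.closedPoint O → ringKrullDim (X'.presheaf.stalk x) = (n + 1 : ℕ))
    (X' : Scheme.{0}) (σ' : X' ⟶ P) (S' : Set X') (hCh : Ch X' σ' S')
    (Γ : Scheme.{0}) (e : Γ ≅ (vanishingIdeal (⟨closure S', isClosed_closure⟩ : Closeds X')).subscheme)
    (hres : ∃ Γs : Scheme.{0}, (∀ R : Scheme.{0} → Prop, (∀ (X X' : Scheme.{0}), Nonempty (X ≅ X') → R X → R X') → R Γ →
      (∀ (Γ₁ Γ₂ : Scheme.{0}) (x : Γ₁) (hx : IsClosed ({x} : Set Γ₁)) (υ : Γ₂ ⟶ Γ₁), R Γ₁ →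
        ¬ IsRegularLocalRing (Γ₁.presheaf.stalk x) → (maximalIdeal (Γ₁.presheaf.stalk x)).spanFinrank ≤ n →
        IsBlowup υ (vanishingIdeal ⟨{x}, hx⟩) → R Γ₂) → R Γs) ∧
      Scheme.IsRegular Γs) :
    ∃ (X₁ : Scheme.{0}) (σ₁ : X₁ ⟶ P) (S₁ : Set X₁), Ch X₁ σ₁ S₁ ∧
      Scheme.IsRegular (vanishingIdeal (⟨closure S₁, isClosed_closure⟩ : Closeds X₁)).subscheme :=
  horizChainE1_of_pointResolvableInv O P q Y Ch hChain hStep hq hqp hY hYirr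
    (fun Γ₁ x => (maximalIdeal (Γ₁.presheaf.stalk x)).spanFinrank ≤ n) (spanFinrank_maximalIdeal_stalk_le_of_iso n)
    (hMS_of_multisection O P q Y Ch hChain hq hY hYirr n hdim) X' σ' S' hCh Γ e hres

end Summit.ResolutionOfSingularities.ResolutionOfSingularities.Cruxes.EquisingularLiftNat.Sections
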